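import Mathlib
import HarnessLib

/-!
# Invariant blocks of equivariant block operators are group AVERAGES (negative lemma for K2ᵀ, rung-1 g6)

Crux `stmt-HodgeConjecture-28148` (K2ᵀ, `Theses.KleimanBFSeeds.TwistNormalisedKleimanSemiregularAnchor`), line
`Cruxes/TwistNormalisedKleimanSemiregularAnchor/Lines/chosen_anchor.lean`, stub `stub_rung_CMclass_d3 : KleimanAnchorRungCM 3`.
HONEST LABEL: a `--supports` helper (Negative/ lane); it neither proves nor refutes the rung, K2ᵀ, `WeilSixfolds`, HC_AV,
HC_CM or HC. What is KERNEL-CHECKED is only elementary linear algebra (§2); the identification with the `Ext` groups of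
§1 is PEN, recorded in the crux memo `CENSUS-6-ONE-CURVE-rung1-g6.md` (same crux directory of the tree).

## §1 The pen chain (what the lemmas are the shadow of)

Gate GV♯ of `CENSUS-5-POINCARE-HALF-SLOPE-rung1-g5.md` §2.5 asks whether `Ext²_A(Ē̄, Ē̄ ⊗ L_χ) = 0` for the `4095`
non-trivial `2`-torsion line bundles `L_χ` on `A = (X × X̂)/Ḡ`, `Ē̄` Markman's semiregular secant sheaf
[cite: Markman2025SecantWeil, §1.5 and §9.3]. By Orlov's equivalence and Künneth this reduces, factor by factor, to
the `G₁`-INVARIANT part of `Ext•_X(𝓘_Z, 𝓘_{Z+v} ⊗ M′)`, where `X = J(C)` (`C` a non-hyperelliptic genus-`3` curve),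
`Z = ⊔_{g ∈ G₁} (C + g)` is the `G₁`-orbit (`G₁ ⊂ X` cyclic of order `13`) of the Abel–Jacobi curve, `v ∈ X[2]`,
`M′ ∈ Pic⁰(X)[2]` [cite: Markman2025SecantWeil, §1.5 (the equivariant construction) and Lemma 8.3.2]. For `M′ ≠ 𝒪` the
local-to-global sequence gives `Ext¹ = ker B`, `Ext² = coker B` for a `G₁`-EQUIVARIANT block operator

  `B : ⊕_{i ∈ G₁} H⁰(C + i, ω ⊗ M′) → ⊕_{h ∈ G₁} H¹(C + v + h, M′)`, block `(i, h)` = the one-pair connecting map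
  for the pair of disjoint curves `(C + i, C + v + h)`, which depends only on the class `h − i`

(after transporting all blocks to `V := H⁰(C, ω ⊗ η)`, `W := H¹(C, η)` by translation). CENSUS-5 §2.5 «CORE» identified
the invariant block of `B` with the SINGLE block `h − i = 0` (the «one-curve question» on `J(C)`). §2 below records the
correct bookkeeping: the invariant block of an equivariant block-«circulant» operator is the SUM over the group of the
blocks (`blockCirculant_apply_const`, `blockCirculant_const_eq_zero_iff`) — equivalently the one-pair map on the
ISOGENOUS threefold `X/G₁` — and invertibility of every single block does NOT imply invertibility of the sum
(`exists_blocks_bijective_sum_eq_zero`), nor does one vanishing block force a kernel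
(`sum_blocks_eq_card_sub_one_smul`: twelve equal invertible blocks and one zero block have invertible sum in
characteristic `0`). So the one-curve answer on `J(C)` (CENSUS-6 THEOREM 1: the single block is an isomorphism iff
`M′ ≠ t_v^*𝒪(Θ) ⊗ 𝒪(−Θ)`, and is ZERO on that diagonal) decides GV♯ in NEITHER direction; the residual gate is the
one-pair map on `X/G₁` (CENSUS-6 §3).

## §2 What is proved (elementary, any commutative ring / field)

* `blockCirculant_apply_const`: `Σ_i D(h − i) v = Σ_k D(k) v` — on constant (invariant) vectors the block operator
  acts by the SUM of the blocks; `blockCirculant_shift`: equivariance under the regular shift.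
* `blockCirculant_const_eq_zero_iff`: a constant vector lies in `ker B` iff `v ∈ ker (Σ_k D k)`.
* `exists_blocks_bijective_sum_eq_zero`: over `ℤ/2`-indexed blocks `D₀ = id`, `D₁ = −id` every block is bijective
  and `Σ_k D_k = 0` (so «every pair map is an isomorphism» does not give «invariant `Ext¹ = 0`»).
* `sum_blocks_eq_card_sub_one_smul`: if `D 0 = 0` and `D k = D₀` for `k ≠ 0` then `Σ_k D k = (|G| − 1) • D₀`
  (so «the diagonal pair map vanishes» does not give «invariant `Ext¹ ≠ 0`»).

References: [cite: Markman2025SecantWeil, §1.5, Lemma 8.3.2, §9.3] [cite: BuchweitzFlenner2003, §5 Thm. 5.1]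
[cite: Mukai1981FourierFunctor, Thm. 2.2 and (3.1)].
-/

-- every declaration of this problem lives in `Summit.HodgeConjecture.HodgeConjecture.…` (summit = sub-problem)
set_option linter.dupNamespace false

namespace Summit.HodgeConjecture.HodgeConjecture.Theorems.TwistNormalisedKleimanSemiregularAnchor.Negative

open Finset

section BlockCirculant

variable {R : Type*} [CommRing R] {G : Type*} [AddCommGroup G] [Fintype G]
  {V W : Type*} [AddCommGroup V] [Module R V] [AddCommGroup W] [Module R W]

/-- **Invariant block = sum of the blocks.** For blocks `D : G → (V →ₗ W)` indexed by the difference class, the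
block operator `(B f)(h) = Σ_i D(h − i)(f i)` applied to the constant vector `f ≡ v` is the constant vector
`Σ_k D(k) v`: on `G`-invariants an equivariant block operator acts by the group SUM (average) of its blocks, not
by the diagonal block. [cite: Markman2025SecantWeil, §1.5] -/
theorem blockCirculant_apply_const (D : G → V →ₗ[R] W) (v : V) (h : G) :
    (∑ i : G, D (h - i) v) = ∑ k : G, D k v :=
  Fintype.sum_equiv (Equiv.subLeft h) (fun i => D (h - i) v) (fun k => D k v) fun _ => rfl

/-- **Equivariance** of the block operator under the regular shift `(S_k f)(i) = f(i − k)`: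
`B (S_k f) = S_k (B f)`, i.e. `Σ_i D(h − i) f(i − k) = Σ_i D((h − k) − i) f(i)`. [folklore] -/
theorem blockCirculant_shift (D : G → V →ₗ[R] W) (f : G → V) (k h : G) :
    (∑ i : G, D (h - i) (f (i - k))) = ∑ i : G, D (h - k - i) (f i) := by
  refine Fintype.sum_equiv (Equiv.subRight k) (fun i => D (h - i) (f (i - k)))
    (fun i => D (h - k - i) (f i)) fun i => ?_
  simp only [Equiv.subRight_apply]
  congr 2
  abel

/-- **Kernel on invariants.** The constant vector `v` lies in the kernel of the block operator (every component
`Σ_i D(h − i) v` vanishes) iff `v` lies in the kernel of the SUM of the blocks. [folklore] -/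
theorem blockCirculant_const_eq_zero_iff [Nonempty G] (D : G → V →ₗ[R] W) (v : V) :
    (∀ h : G, (∑ i : G, D (h - i) v) = 0) ↔ (∑ k : G, D k) v = 0 := by
  rw [LinearMap.sum_apply]
  constructor
  · intro hB
    obtain ⟨h⟩ := ‹Nonempty G›
    rw [← blockCirculant_apply_const D v h]
    exact hB h
  · intro hv h
    rw [blockCirculant_apply_const D v h]
    exact hv

/-- **Type-III shape**: if the diagonal block vanishes (`D 0 = 0`) and all off-diagonal blocks equal `D₀`, the
invariant block is `(|G| − 1) • D₀` — invertible as soon as `D₀` is and `|G| − 1` is a unit (e.g. `|G| = 13` in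
characteristic `0`): a vanishing diagonal pair map forces NO invariant kernel. [folklore] -/
theorem sum_blocks_eq_card_sub_one_smul [DecidableEq G] (D : G → V →ₗ[R] W) (D₀ : V →ₗ[R] W)
    (h0 : D 0 = 0) (hoff : ∀ k : G, k ≠ 0 → D k = D₀) :
    (∑ k : G, D k) = (Fintype.card G - 1) • D₀ := by
  have hsplit : (∑ k : G, D k) = ∑ k ∈ (Finset.univ : Finset G).erase 0, D k := by
    rw [← Finset.add_sum_erase _ _ (Finset.mem_univ (0 : G)), h0, zero_add]
  rw [hsplit, Finset.sum_congr rfl fun k hk => hoff k (Finset.ne_of_mem_erase hk), Finset.sum_const,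
    Finset.card_erase_of_mem (Finset.mem_univ _), Finset.card_univ]

end BlockCirculant

section Obstruction

/-- **Every block invertible ⇏ invariant block invertible.** With blocks indexed by `ℤ/2`, `D 0 = id` and
`D 1 = −id` on any module: each block is bijective, yet `Σ_k D k = 0`. Hence «every one-pair map is an
isomorphism» (CENSUS-6 THEOREM 1 off the diagonal) does not imply that the `G`-invariant `Ext¹` vanishes.
[folklore] -/
theorem exists_blocks_bijective_sum_eq_zero (R V : Type*) [CommRing R] [AddCommGroup V] [Module R V] :
    ∃ D : ZMod 2 → V →ₗ[R] V, (∀ k, Function.Bijective (D k)) ∧ (∑ k : ZMod 2, D k) = 0 := by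
  refine ⟨fun k => if k = 0 then LinearMap.id else -LinearMap.id, fun k => ?_, ?_⟩
  · by_cases hk : k = 0
    · simp only [hk, if_true]
      exact Function.bijective_id
    · simp only [hk, if_false]
      refine Function.Involutive.bijective fun x => ?_
      simp
  · have huniv : (Finset.univ : Finset (ZMod 2)) = {0, 1} := by decide
    rw [huniv, Finset.sum_pair (by decide)]
    simp

/-- **The same obstruction, stated for the block operator**: there are `ℤ/2`-indexed blocks on `R` (as a module
over itself), all bijective, whose block operator kills the non-zero invariant vector `(1, 1)` whenever `1 ≠ 0`.
[folklore] -/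
theorem exists_blockCirculant_bijective_const_mem_ker (R : Type*) [CommRing R] :
    ∃ D : ZMod 2 → R →ₗ[R] R, (∀ k, Function.Bijective (D k)) ∧
      ∀ h : ZMod 2, (∑ i : ZMod 2, D (h - i) (1 : R)) = 0 := by
  obtain ⟨D, hbij, hsum⟩ := exists_blocks_bijective_sum_eq_zero R R
  refine ⟨D, hbij, fun h => ?_⟩
  rw [blockCirculant_apply_const D 1 h, ← LinearMap.sum_apply, hsum, LinearMap.zero_apply]

end Obstruction

section AlternatingBlock

/-! ### §3 (appended, rung-1 g6): an ALTERNATING `2 × 2` block is zero or invertible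

For the TYPE-III characters (`e₂(v, M′) = −1`, `2016` of the `3969` residual ones; CENSUS-6 §3.3b/§3.7) the pen
PROPOSITION S of hodge-idea-1 g16 (`MEMO-negation-g16.md` §4b: linking symmetry + Serre duality + the
`ℤ/2`-linearisation) makes the Gram matrix of the invariant `2 × 2` block on `X/G_ℓ` ALTERNATING (for the symmetric
types I — the diagonal `M′ = P_{φ(v)}` — and II it is symmetric; ERRATUM to rev 1 of this comment, which said
«diagonal type»). The lemmas below record the consequence: an alternating `2 × 2` matrix over a field has
`det = (M₀₁)²`, hence is either `0` or invertible, so the type-III invariant `Ext¹` is `0` or all of `ℂ²` — one bit,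
decided (PASS, `Ext¹ = 0` generically) by the boundary computation CENSUS-6 §3.7 THEOREM 2. [folklore] -/

variable {K : Type*} [Field K]

/-- `det` of an alternating `2 × 2` matrix is the square of its off-diagonal entry. [folklore] -/
theorem det_fin_two_of_alternating (M : Matrix (Fin 2) (Fin 2) K) (h00 : M 0 0 = 0) (h11 : M 1 1 = 0)
    (h10 : M 1 0 = -M 0 1) : M.det = (M 0 1) ^ 2 := by
  rw [Matrix.det_fin_two, h00, h11, h10]
  ring

/-- An alternating `2 × 2` matrix over a field is either `0` or has non-zero determinant. [folklore] -/
theorem eq_zero_or_det_ne_zero_of_alternating (M : Matrix (Fin 2) (Fin 2) K) (h00 : M 0 0 = 0)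
    (h11 : M 1 1 = 0) (h10 : M 1 0 = -M 0 1) : M = 0 ∨ M.det ≠ 0 := by
  by_cases h : M 0 1 = 0
  · left
    ext i j
    fin_cases i <;> fin_cases j <;> simp [h00, h11, h10, h]
  · right
    rw [det_fin_two_of_alternating M h00 h11 h10]
    exact pow_ne_zero 2 h

/-- Hence its rank is `0` or `2`: the kernel of an alternating `2 × 2` block (the invariant `Ext¹` of a type-III
character, CENSUS-6 §3.3b/§3.7) is either everything or trivial — one bit. [folklore] -/
theorem rank_eq_zero_or_two_of_alternating (M : Matrix (Fin 2) (Fin 2) K) (h00 : M 0 0 = 0)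
    (h11 : M 1 1 = 0) (h10 : M 1 0 = -M 0 1) : M.rank = 0 ∨ M.rank = 2 := by
  rcases eq_zero_or_det_ne_zero_of_alternating M h00 h11 h10 with h | h
  · left
    rw [h, Matrix.rank_zero]
  · right
    have hu : IsUnit M := (Matrix.isUnit_iff_isUnit_det M).2 (isUnit_iff_ne_zero.2 h)
    simpa using Matrix.rank_of_isUnit M hu

end AlternatingBlock

end Summit.HodgeConjecture.HodgeConjecture.Theorems.TwistNormalisedKleimanSemiregularAnchor.Negative
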